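import Summits.Ventures.PercRepro.C041TriDomTwoCutChord
import Summits.Ventures.PercRepro.C041TriDomTwoCutCountMain

/-!
# ROW C-041 — THEOREM (2-CUT GLUING): A MARKLESS FAR SIDE ON A PAIR OF VERTICES IS INVISIBLE, GIVEN A CHORD
(p6, gen 46; P6-TWOEXIT-LEAN.md §53 ADDENDUM 18)

**THEOREM (2-CUT GLUING)** (`cycDominationS_of_twoCut`, `sibDominationS_of_twoCut`).  Let `{u, v}` be a pair of
vertices with a far side `C = side2 st u v w` carrying NO MARK, and let `c₀` be a host edge joining `u` and `v` that
is ABSENT in `st`.  If CONJECTURE (STOCHASTIC DOMINATION) holds on `stOut2S` (the far side deleted), on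
`stDbl` (the far side replaced by the double chord `c₀`) and on `stChord` (the far side replaced by the free chord
`c₀`), it holds on `st`; the same for the sibling domination.  PROOF: THE 2-CUT COUNT (part IV) with the far
connectivities `r i = u ~_R v`, `bl i = u ~_B v` inside the far side, the cut-relation of the classes from THE
THROUGH-LEMMA realised on the chord (part II: `cycCrossed_cutRel`, `topBot_cutRel`, the sibling twins), and THE
TRANSPORT `ψ` of the `B`-type inside parts into the `R`-type ones — THEOREM (TWO-MARK DOMINATION) on `stIn2S` for
the pair `(u, v)`, pulled back along the inside part, and Hall (`exists_transport2`).
READING: a markless piece hanging on TWO VERTICES is absorbed like one hanging on two edges, at the price of the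
statements on the host with the piece replaced by a chord — the host needs an absent chord to carry it.
-/

namespace PercRepro

namespace ZoneZ

namespace MultiExit

open ZoneData Finset Classical

variable {V₁ E₁ U₁ U₂ : Type} (Z₁ : ZoneData V₁ E₁ U₁ U₂) [Fintype E₁] [DecidableEq E₁]
variable {st : E₁ → EStat} {u v w : V₁} {c₀ : E₁}

/-! ## The far connectivities and the colours they read -/

omit [Fintype E₁] [DecidableEq E₁] in
/-- The inside part agrees with the colouring on the far side. -/
theorem inN_agree_in (ω : E₁ → Bool) : ∀ e, InC2S Z₁ st u v w e → ω e = inN (InC2S Z₁ st u v w) ω e := by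
  intro e he
  unfold inN
  rw [merge_of_in _ _ _ he]

omit [Fintype E₁] [DecidableEq E₁] in
/-- A merge agrees with its inside part on the far side. -/
theorem merge_agree_in (o i : E₁ → Bool) :
    ∀ e, InC2S Z₁ st u v w e → merge (InC2S Z₁ st u v w) o i e = i e := by
  intro e he
  rw [merge_of_in _ _ _ he]

omit [Fintype E₁] [DecidableEq E₁] in
/-- A merge agrees with its outside part off the far side. -/
theorem merge_agree_out (o i : E₁ → Bool) :
    ∀ e, ¬ InC2S Z₁ st u v w e → merge (InC2S Z₁ st u v w) o i e = o e := by
  intro e he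
  rw [merge_of_not_in _ _ _ he]

omit [Fintype E₁] in
/-- A free edge of `stChord` is the chord or an edge off the far side. -/
theorem stChord_free_cases (hwu : w ≠ u) (hwv : w ≠ v) (hc : Z₁.Joins c₀ u v) {e : E₁}
    (h : stChord Z₁ st u v w c₀ e = EStat.free) : ¬ InC2S Z₁ st u v w e := by
  unfold stChord at h
  by_cases hec : e = c₀
  · rw [hec]
    exact not_InC2S_chord Z₁ hwu hwv hc
  · rw [if_neg hec] at h
    exact not_InC2S_of_stOut2S_free Z₁ h

omit [Fintype E₁] in
/-- A free edge of `stDbl` is off the far side. -/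
theorem stDbl_free_cases {e : E₁} (h : stDbl Z₁ st u v w c₀ e = EStat.free) : ¬ InC2S Z₁ st u v w e := by
  unfold stDbl at h
  by_cases hec : e = c₀
  · rw [if_pos hec] at h
    exact absurd h (by decide)
  · rw [if_neg hec] at h
    exact not_InC2S_of_stOut2S_free Z₁ h

omit [Fintype E₁] in
/-- The connectivities of `stChord` read only the edges off the far side. -/
theorem RdS_stChord_congr_out (hwu : w ≠ u) (hwv : w ≠ v) (hc : Z₁.Joins c₀ u v) {ω ω' : E₁ → Bool}
    (h : ∀ e, ¬ InC2S Z₁ st u v w e → ω e = ω' e) :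
    RdS Z₁ (stChord Z₁ st u v w c₀) ω = RdS Z₁ (stChord Z₁ st u v w c₀) ω' :=
  RdS_congr_free Z₁ _ fun e he => h e (stChord_free_cases Z₁ hwu hwv hc he)

omit [Fintype E₁] in
/-- The blue connectivities of `stChord` read only the edges off the far side. -/
theorem MgS_stChord_congr_out (hwu : w ≠ u) (hwv : w ≠ v) (hc : Z₁.Joins c₀ u v) {ω ω' : E₁ → Bool}
    (h : ∀ e, ¬ InC2S Z₁ st u v w e → ω e = ω' e) :
    MgS Z₁ (stChord Z₁ st u v w c₀) ω = MgS Z₁ (stChord Z₁ st u v w c₀) ω' :=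
  MgS_congr_free Z₁ _ fun e he => h e (stChord_free_cases Z₁ hwu hwv hc he)

omit [Fintype E₁] in
/-- The connectivities of `stDbl` read only the edges off the far side. -/
theorem RdS_stDbl_congr_out {ω ω' : E₁ → Bool} (h : ∀ e, ¬ InC2S Z₁ st u v w e → ω e = ω' e) :
    RdS Z₁ (stDbl Z₁ st u v w c₀) ω = RdS Z₁ (stDbl Z₁ st u v w c₀) ω' :=
  RdS_congr_free Z₁ _ fun e he => h e (stDbl_free_cases Z₁ he)

omit [Fintype E₁] in
/-- The blue connectivities of `stDbl` read only the edges off the far side. -/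
theorem MgS_stDbl_congr_out {ω ω' : E₁ → Bool} (h : ∀ e, ¬ InC2S Z₁ st u v w e → ω e = ω' e) :
    MgS Z₁ (stDbl Z₁ st u v w c₀) ω = MgS Z₁ (stDbl Z₁ st u v w c₀) ω' :=
  MgS_congr_free Z₁ _ fun e he => h e (stDbl_free_cases Z₁ he)

omit [Fintype E₁] [DecidableEq E₁] in
/-- The outside part agrees with the colouring off the far side. -/
theorem outN_agree_out (ω : E₁ → Bool) :
    ∀ e, ¬ InC2S Z₁ st u v w e → ω e = outN (InC2S Z₁ st u v w) ω e := by
  intro e he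
  unfold outN
  rw [merge_of_not_in _ _ _ he]

omit [Fintype E₁] in
/-- Recolouring the chord of a merge is recolouring the chord of its outside part, off the far side. -/
theorem update_merge_agree_out (o i : E₁ → Bool) (b : Bool) :
    ∀ e, ¬ InC2S Z₁ st u v w e →
      Function.update (merge (InC2S Z₁ st u v w) o i) c₀ b e = Function.update o c₀ b e := by
  intro e he
  by_cases hec : e = c₀
  · rw [hec, Function.update_self, Function.update_self]
  · rw [Function.update_of_ne hec, Function.update_of_ne hec, merge_of_not_in _ _ _ he]

/-! ## The connectivities of a merge, sorted by the far type of the inside part -/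

section Conn

variable (hwu : w ≠ u) (hwv : w ≠ v) (hc₀ : st c₀ = EStat.absent) (hc : Z₁.Joins c₀ u v)
include hwu hwv

omit [Fintype E₁] [DecidableEq E₁] in
/-- `N`-type: the connectivities of `st` at a merge are those of `stOut2S` at the outside part. -/
theorem conn_N (o i : E₁ → Bool) (hr : ¬ RdS Z₁ (stIn2S Z₁ st u v w) i u v)
    (hb : ¬ MgS Z₁ (stIn2S Z₁ st u v w) i u v) {a b : V₁} (ha : a ∉ side2 Z₁ st u v w)
    (hb' : b ∉ side2 Z₁ st u v w) :
    (RdS Z₁ st (merge (InC2S Z₁ st u v w) o i) a b ↔ RdS Z₁ (stOut2S Z₁ st u v w) o a b) ∧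
      (MgS Z₁ st (merge (InC2S Z₁ st u v w) o i) a b ↔ MgS Z₁ (stOut2S Z₁ st u v w) o a b) := by
  have hr' : ¬ RdS Z₁ (stIn2S Z₁ st u v w) (merge (InC2S Z₁ st u v w) o i) u v := by
    rw [RdS_stIn2S_congr_in Z₁ (merge_agree_in Z₁ o i)]
    exact hr
  have hb'' : ¬ MgS Z₁ (stIn2S Z₁ st u v w) (merge (InC2S Z₁ st u v w) o i) u v := by
    rw [MgS_stIn2S_congr_in Z₁ (merge_agree_in Z₁ o i)]
    exact hb
  constructor
  · rw [RdS_st_iff_stOut2S Z₁ hwu hwv _ hr' ha hb', RdS_stOut2S_congr_out Z₁ (merge_agree_out Z₁ o i)]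
  · rw [MgS_st_iff_stOut2S Z₁ hwu hwv _ hb'' ha hb', MgS_stOut2S_congr_out Z₁ (merge_agree_out Z₁ o i)]

include hc₀ hc

omit [Fintype E₁] in
/-- `D`-type: the connectivities of `st` at a merge are those of `stDbl` at the outside part. -/
theorem conn_D (o i : E₁ → Bool) (hr : RdS Z₁ (stIn2S Z₁ st u v w) i u v)
    (hb : MgS Z₁ (stIn2S Z₁ st u v w) i u v) {a b : V₁} (ha : a ∉ side2 Z₁ st u v w)
    (hb' : b ∉ side2 Z₁ st u v w) :
    (RdS Z₁ st (merge (InC2S Z₁ st u v w) o i) a b ↔ RdS Z₁ (stDbl Z₁ st u v w c₀) o a b) ∧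
      (MgS Z₁ st (merge (InC2S Z₁ st u v w) o i) a b ↔ MgS Z₁ (stDbl Z₁ st u v w c₀) o a b) := by
  have hr' : RdS Z₁ (stIn2S Z₁ st u v w) (merge (InC2S Z₁ st u v w) o i) u v := by
    rw [RdS_stIn2S_congr_in Z₁ (merge_agree_in Z₁ o i)]
    exact hr
  have hb'' : MgS Z₁ (stIn2S Z₁ st u v w) (merge (InC2S Z₁ st u v w) o i) u v := by
    rw [MgS_stIn2S_congr_in Z₁ (merge_agree_in Z₁ o i)]
    exact hb
  constructor
  · rw [RdS_st_iff_stDbl Z₁ hwu hwv hc₀ hc _ hr' ha hb', RdS_stDbl_congr_out Z₁ (merge_agree_out Z₁ o i)]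
  · rw [MgS_st_iff_stDbl Z₁ hwu hwv hc₀ hc _ hb'' ha hb', MgS_stDbl_congr_out Z₁ (merge_agree_out Z₁ o i)]

omit [Fintype E₁] in
/-- `R`/`B`-type: the connectivities of `st` at a merge are those of `stChord` at the outside part with the chord
coloured by the red far connectivity. -/
theorem conn_C (o i : E₁ → Bool)
    (hrb : MgS Z₁ (stIn2S Z₁ st u v w) i u v ↔ ¬ RdS Z₁ (stIn2S Z₁ st u v w) i u v) {a b : V₁}
    (ha : a ∉ side2 Z₁ st u v w) (hb' : b ∉ side2 Z₁ st u v w) :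
    (RdS Z₁ st (merge (InC2S Z₁ st u v w) o i) a b ↔ RdS Z₁ (stChord Z₁ st u v w c₀)
        (Function.update o c₀ (decide (RdS Z₁ (stIn2S Z₁ st u v w) i u v))) a b) ∧
      (MgS Z₁ st (merge (InC2S Z₁ st u v w) o i) a b ↔ MgS Z₁ (stChord Z₁ st u v w c₀)
        (Function.update o c₀ (decide (RdS Z₁ (stIn2S Z₁ st u v w) i u v))) a b) := by
  have hin : RdS Z₁ (stIn2S Z₁ st u v w) (merge (InC2S Z₁ st u v w) o i) = RdS Z₁ (stIn2S Z₁ st u v w) i :=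
    RdS_stIn2S_congr_in Z₁ (merge_agree_in Z₁ o i)
  have hin' : MgS Z₁ (stIn2S Z₁ st u v w) (merge (InC2S Z₁ st u v w) o i) = MgS Z₁ (stIn2S Z₁ st u v w) i :=
    MgS_stIn2S_congr_in Z₁ (merge_agree_in Z₁ o i)
  have hrb' : MgS Z₁ (stIn2S Z₁ st u v w) (merge (InC2S Z₁ st u v w) o i) u v ↔
      ¬ RdS Z₁ (stIn2S Z₁ st u v w) (merge (InC2S Z₁ st u v w) o i) u v := by
    rw [hin, hin']
    exact hrb
  constructor
  · rw [RdS_st_iff_stChord Z₁ hwu hwv hc₀ hc _ ha hb', hin,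
      RdS_stChord_congr_out Z₁ hwu hwv hc (update_merge_agree_out Z₁ o i _)]
  · rw [MgS_st_iff_stChord Z₁ hwu hwv hc₀ hc _ hrb' ha hb', hin,
      MgS_stChord_congr_out Z₁ hwu hwv hc (update_merge_agree_out Z₁ o i _)]

end Conn

/-! ## The classes are cut-related -/

/-- The crossed classes of `st` are cut-related to those of the three chord statuses. -/
theorem cycCrossed_cutRel (hwu : w ≠ u) (hwv : w ≠ v) (hc₀ : st c₀ = EStat.absent) (hc : Z₁.Joins c₀ u v)
    (x y z : V₁) (hx : x ∉ side2 Z₁ st u v w) (hy : y ∉ side2 Z₁ st u v w) (hz : z ∉ side2 Z₁ st u v w) :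
    CutRel (InC2S Z₁ st u v w) c₀ (fun i => RdS Z₁ (stIn2S Z₁ st u v w) i u v)
      (fun i => MgS Z₁ (stIn2S Z₁ st u v w) i u v) (CycCrossedS Z₁ x y z st)
      (CycCrossedS Z₁ x y z (stOut2S Z₁ st u v w)) (CycCrossedS Z₁ x y z (stDbl Z₁ st u v w c₀))
      (CycCrossedS Z₁ x y z (stChord Z₁ st u v w c₀)) where
  hN o i _ _ hr hb := by
    rw [cycCrossedS_iff, cycCrossedS_iff, (conn_N Z₁ hwu hwv o i hr hb hx hy).1, (conn_N Z₁ hwu hwv o i hr hb hx hz).1,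
      (conn_N Z₁ hwu hwv o i hr hb hy hz).1, (conn_N Z₁ hwu hwv o i hr hb hx hy).2, (conn_N Z₁ hwu hwv o i hr hb hx hz).2,
      (conn_N Z₁ hwu hwv o i hr hb hy hz).2]
  hD o i _ _ hr hb := by
    rw [cycCrossedS_iff, cycCrossedS_iff, (conn_D Z₁ hwu hwv hc₀ hc o i hr hb hx hy).1,
      (conn_D Z₁ hwu hwv hc₀ hc o i hr hb hx hz).1, (conn_D Z₁ hwu hwv hc₀ hc o i hr hb hy hz).1,
      (conn_D Z₁ hwu hwv hc₀ hc o i hr hb hx hy).2, (conn_D Z₁ hwu hwv hc₀ hc o i hr hb hx hz).2,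
      (conn_D Z₁ hwu hwv hc₀ hc o i hr hb hy hz).2]
  hC o i _ _ hrb := by
    rw [cycCrossedS_iff, cycCrossedS_iff, (conn_C Z₁ hwu hwv hc₀ hc o i hrb hx hy).1,
      (conn_C Z₁ hwu hwv hc₀ hc o i hrb hx hz).1, (conn_C Z₁ hwu hwv hc₀ hc o i hrb hy hz).1,
      (conn_C Z₁ hwu hwv hc₀ hc o i hrb hx hy).2, (conn_C Z₁ hwu hwv hc₀ hc o i hrb hx hz).2,
      (conn_C Z₁ hwu hwv hc₀ hc o i hrb hy hz).2]
  hout ω := by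
    refine ⟨?_, ?_, ?_⟩
    · rw [cycCrossedS_iff, cycCrossedS_iff, RdS_stOut2S_congr_out Z₁ (outN_agree_out Z₁ ω),
        MgS_stOut2S_congr_out Z₁ (outN_agree_out Z₁ ω)]
    · rw [cycCrossedS_iff, cycCrossedS_iff, RdS_stDbl_congr_out Z₁ (outN_agree_out Z₁ ω),
        MgS_stDbl_congr_out Z₁ (outN_agree_out Z₁ ω)]
    · rw [cycCrossedS_iff, cycCrossedS_iff, RdS_stChord_congr_out Z₁ hwu hwv hc (outN_agree_out Z₁ ω),
        MgS_stChord_congr_out Z₁ hwu hwv hc (outN_agree_out Z₁ ω)]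

/-- The class `(⊤, ⊥)` of `st` is cut-related to those of the three chord statuses. -/
theorem topBot_cutRel (hwu : w ≠ u) (hwv : w ≠ v) (hc₀ : st c₀ = EStat.absent) (hc : Z₁.Joins c₀ u v)
    (x y z : V₁) (hx : x ∉ side2 Z₁ st u v w) (hy : y ∉ side2 Z₁ st u v w) (hz : z ∉ side2 Z₁ st u v w) :
    CutRel (InC2S Z₁ st u v w) c₀ (fun i => RdS Z₁ (stIn2S Z₁ st u v w) i u v)
      (fun i => MgS Z₁ (stIn2S Z₁ st u v w) i u v) (TopBotS Z₁ x y z st)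
      (TopBotS Z₁ x y z (stOut2S Z₁ st u v w)) (TopBotS Z₁ x y z (stDbl Z₁ st u v w c₀))
      (TopBotS Z₁ x y z (stChord Z₁ st u v w c₀)) where
  hN o i _ _ hr hb := by
    rw [topBotS_iff, topBotS_iff, (conn_N Z₁ hwu hwv o i hr hb hx hy).1, (conn_N Z₁ hwu hwv o i hr hb hx hz).1,
      (conn_N Z₁ hwu hwv o i hr hb hy hz).1, (conn_N Z₁ hwu hwv o i hr hb hx hy).2, (conn_N Z₁ hwu hwv o i hr hb hx hz).2,
      (conn_N Z₁ hwu hwv o i hr hb hy hz).2]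
  hD o i _ _ hr hb := by
    rw [topBotS_iff, topBotS_iff, (conn_D Z₁ hwu hwv hc₀ hc o i hr hb hx hy).1,
      (conn_D Z₁ hwu hwv hc₀ hc o i hr hb hx hz).1, (conn_D Z₁ hwu hwv hc₀ hc o i hr hb hy hz).1,
      (conn_D Z₁ hwu hwv hc₀ hc o i hr hb hx hy).2, (conn_D Z₁ hwu hwv hc₀ hc o i hr hb hx hz).2,
      (conn_D Z₁ hwu hwv hc₀ hc o i hr hb hy hz).2]
  hC o i _ _ hrb := by
    rw [topBotS_iff, topBotS_iff, (conn_C Z₁ hwu hwv hc₀ hc o i hrb hx hy).1,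
      (conn_C Z₁ hwu hwv hc₀ hc o i hrb hx hz).1, (conn_C Z₁ hwu hwv hc₀ hc o i hrb hy hz).1,
      (conn_C Z₁ hwu hwv hc₀ hc o i hrb hx hy).2, (conn_C Z₁ hwu hwv hc₀ hc o i hrb hx hz).2,
      (conn_C Z₁ hwu hwv hc₀ hc o i hrb hy hz).2]
  hout ω := by
    refine ⟨?_, ?_, ?_⟩
    · rw [topBotS_iff, topBotS_iff, RdS_stOut2S_congr_out Z₁ (outN_agree_out Z₁ ω),
        MgS_stOut2S_congr_out Z₁ (outN_agree_out Z₁ ω)]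
    · rw [topBotS_iff, topBotS_iff, RdS_stDbl_congr_out Z₁ (outN_agree_out Z₁ ω),
        MgS_stDbl_congr_out Z₁ (outN_agree_out Z₁ ω)]
    · rw [topBotS_iff, topBotS_iff, RdS_stChord_congr_out Z₁ hwu hwv hc (outN_agree_out Z₁ ω),
        MgS_stChord_congr_out Z₁ hwu hwv hc (outN_agree_out Z₁ ω)]

/-! ## The transport -/

/-- **THE TRANSPORT** on the far side of a pair: a red-ward injection of the `B`-type inside parts into the
`R`-type ones (THEOREM (TWO-MARK DOMINATION) on `stIn2S` for the pair `(u, v)`, pulled back along the inside part,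
and Hall). -/
theorem exists_transport2 : ∃ ψ : (E₁ → Bool) → (E₁ → Bool),
    Set.InjOn ψ ↑((InSupp (InC2S Z₁ st u v w)).filter fun i =>
      MgS Z₁ (stIn2S Z₁ st u v w) i u v ∧ ¬ RdS Z₁ (stIn2S Z₁ st u v w) i u v) ∧
    ∀ i ∈ InSupp (InC2S Z₁ st u v w), MgS Z₁ (stIn2S Z₁ st u v w) i u v → ¬ RdS Z₁ (stIn2S Z₁ st u v w) i u v →
      ψ i ∈ InSupp (InC2S Z₁ st u v w) ∧
        (RdS Z₁ (stIn2S Z₁ st u v w) (ψ i) u v ∧ ¬ MgS Z₁ (stIn2S Z₁ st u v w) (ψ i) u v) ∧ LeCol i (ψ i) := by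
  set In := InC2S Z₁ st u v w with hIn
  set IB := (InSupp In).filter fun i => MgS Z₁ (stIn2S Z₁ st u v w) i u v ∧ ¬ RdS Z₁ (stIn2S Z₁ st u v w) i u v
    with hIB
  set IR := (InSupp In).filter fun i => RdS Z₁ (stIn2S Z₁ st u v w) i u v ∧ ¬ MgS Z₁ (stIn2S Z₁ st u v w) i u v
    with hIR
  have hall : ∀ V : (E₁ → Bool) → Prop, UpSet V → (IB.filter V).card ≤ (IR.filter V).card := by
    intro V hV
    have h := count_blue_only_le_count_red_only_S Z₁ (stIn2S Z₁ st u v w) u v (upSet_pullIn In hV)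
    have hin : ∀ P : (E₁ → Bool) → Prop, (∀ ω, P ω ↔ P (inN In ω)) →
        (univ.filter fun ω : E₁ → Bool => V (inN In ω) ∧ P ω).card =
          (OutSupp In).card * ((InSupp In).filter fun i => V (inN In i) ∧ P i).card := by
      intro P hP
      rw [card_filter_inOnly In _ fun ω => ?_]
      rw [inN_inN, ← hP]
    have hL := hin (fun ω => MgS Z₁ (stIn2S Z₁ st u v w) ω u v ∧ ¬ RdS Z₁ (stIn2S Z₁ st u v w) ω u v)
      (fun ω => by rw [MgS_stIn2S_congr_in Z₁ (inN_agree_in Z₁ ω), RdS_stIn2S_congr_in Z₁ (inN_agree_in Z₁ ω)])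
    have hR := hin (fun ω => RdS Z₁ (stIn2S Z₁ st u v w) ω u v ∧ ¬ MgS Z₁ (stIn2S Z₁ st u v w) ω u v)
      (fun ω => by rw [MgS_stIn2S_congr_in Z₁ (inN_agree_in Z₁ ω), RdS_stIn2S_congr_in Z₁ (inN_agree_in Z₁ ω)])
    have h' := (hL.symm.trans card_filter_inst).trans_le (h.trans_eq (card_filter_inst.trans hR))
    have h'' := Nat.le_of_mul_le_mul_left h' (card_OutSupp_pos _)
    rw [hIB, hIR, Finset.filter_filter, Finset.filter_filter]
    exact (card_filter_congr' fun i hi => by rw [inN_eq_self _ hi]; tauto).trans_le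
      (h''.trans_eq (card_filter_congr' fun i hi => by rw [inN_eq_self _ hi]; tauto))
  obtain ⟨ψ, hinj, hψ⟩ := exists_monotone_injection IB IR hall
  refine ⟨ψ, hinj, fun i hi hb hr => ?_⟩
  have hiB : i ∈ IB := by
    rw [hIB, Finset.mem_filter]
    exact ⟨hi, hb, hr⟩
  obtain ⟨hmem, hle⟩ := hψ i hiB
  rw [hIR, Finset.mem_filter] at hmem
  exact ⟨hmem.1, hmem.2, hle⟩

/-! ## THEOREM (2-CUT GLUING) -/

/-- **THEOREM (2-CUT GLUING)**: CONJECTURE (STOCHASTIC DOMINATION) on `st` follows from the conjecture on the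
three chord statuses, when the far side of the pair `{u, v}` carries no mark and the host has an absent chord
`c₀ = u–v`. -/
theorem cycDominationS_of_twoCut (hwu : w ≠ u) (hwv : w ≠ v) (hc₀ : st c₀ = EStat.absent) (hc : Z₁.Joins c₀ u v)
    (x y z : V₁) (hx : x ∉ side2 Z₁ st u v w) (hy : y ∉ side2 Z₁ st u v w) (hz : z ∉ side2 Z₁ st u v w)
    (hN : CycDominationS Z₁ x y z (stOut2S Z₁ st u v w)) (hD : CycDominationS Z₁ x y z (stDbl Z₁ st u v w c₀))
    (hC : CycDominationS Z₁ x y z (stChord Z₁ st u v w c₀)) : CycDominationS Z₁ x y z st := by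
  intro V hV
  obtain ⟨ψ, hinj, hψ⟩ := exists_transport2 Z₁ (st := st) (u := u) (v := v) (w := w)
  have key := dom_of_twoCut_count (not_InC2S_chord Z₁ hwu hwv hc)
    (cycCrossed_cutRel Z₁ hwu hwv hc₀ hc x y z hx hy hz) (topBot_cutRel Z₁ hwu hwv hc₀ hc x y z hx hy hz)
    (fun V hV => (card_filter_inst.trans_le (hN V hV)).trans_eq card_filter_inst)
    (fun V hV => (card_filter_inst.trans_le (hD V hV)).trans_eq card_filter_inst)
    (fun V hV => (card_filter_inst.trans_le (hC V hV)).trans_eq card_filter_inst) ψ hψ hinj V hV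
  exact (card_filter_inst.trans_le key).trans_eq card_filter_inst

end MultiExit

end ZoneZ

end PercRepro
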